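import Summits.ABC.IUTFork.Joshi.TestHullOrVolume
import HarnessLib

/-!
# Branch E, X-07‴: VOLUME MATCH — the frame-independent necessary condition that S ∧ Statement imposes
# (second adversary seat abc-iut-E-cx-2)

AUTHORED BY abc-iut-E-cx-2 (refuter seat refuter-abc-iut-E-cx-2-g0-0); proxy-filed VERBATIM by a prover hand per the cell's PROXY
RULE (plan/repair/REPAIR-SPEC.md §2). Record file of the abc-iut cell, branch E «type Joshi's construction, test vs S» (rung
LADDER-ABC:A2.E). **No side is taken** on [IUTchIII] Cor. 3.12, on Joshi's claims (unrefereed arXiv preprints) or on Mochizuki's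
report on them; typed ≠ proved ≠ endorsed. PROOF-ONLY over `Joshi/TestHullOrVolume.lean` (abc-iut-E-cx), `Joshi/DictionaryHarnessBridge.lean`
(p429682), `Joshi/TestHarness.lean` (p428758) and `Cor312PilotKummerCompat.lean` (abc-iut-w5-d232): 0 new `def`, no `Prop` fact, no
instance, no `sorry`.

## Content (generic over the lattice binders `(S, P, ρ, qK)` of S)
S := `Cor312Vol.PilotKummerIndRelated S P ρ qK` is an IDENTITY of regions (`ρ qK = ρ D'.Ψ`, `D' ∈ R^LGP`), equivalently
(`pilotKummerCompatRegion_iff_pilotKummerIndRelated`, under Thm 3.11 (ii)(b) for column `n` and (hρ)) `ρ qK = Φ '' ρ Ψ^{(m)}` for ONE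
`Φ ∈ ⟨(Ind1) ∪ (Ind2)⟩` and one column `m`. Call **volume match at `(j, v_ℚ)`** the sentence
`∃ m, logvol (ρ qK j v_ℚ) = logvol (ρ Ψ^{(m)} j v_ℚ)` (written inline below; no new shape is defined).
* §1 (`exists_logvol_eq_of_pilotKummerIndRelated_of_logvolInvariant`, `not_pilotKummerIndRelated_of_logvolInvariant_of_ne`): if the
  (Ind1)/(Ind2) GENERATORS transport admissibility and preserve log-volume (`MRData.LogvolInvariant`, [IUTchIV] Thm 1.10 Step (v);
  propagated to the subgroup by abc-iut-L6-t13's `MRData.adm_and_logvol_eq_of_mem_closure`), then S ⟹ volume match at EVERY packet;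
  so S FAILS wherever, at one packet, every Θ-Kummer datum region has log-volume DIFFERENT from the q-datum region's. Compared with
  `Joshi.not_indCoversQ_of_logvolInvariant` (X-06, p428758): no `LogvolMono`, no admissibility of the q-region, and `≠` in place of `<` —
  the obstruction is symmetric in the two normalisations (Θ below q: Mochizuki's `q̲^{j²}` vs `q̲` at `j ≥ 2`; Θ ABOVE q: Joshi's rescaled
  Θ-coordinate `|q^{1/2ℓ}|^{j²/ℓ*²}` vs `|q^{1/2ℓ}|` at `j < ℓ*`, [J-III] arXiv:2401.13508 eq. (9.9.4) p.121).
* §2 (dichotomy form, NO volume-invariance hypothesis, NO pins, NO `LogvolMono`): under abc-iut-E-cx's INDETERMINACY DICHOTOMY binder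
  `H1` at a packet (every `Φ ∈ ⟨Ind1 ∪ Ind2⟩` is there EITHER volume-preserving on admissible regions OR hull-destroying; a HYPOTHESIS,
  never asserted — discharged for the cell's ℚ-line carriers by E-t41's `TestIsmDichotomy`), S gives AT THAT PACKET: volume match OR
  `¬HullDefined` (`exists_logvol_eq_or_not_hullDefined_of_pilotKummerCompatRegion`). Hence
  **S ∧ Statement-as-typed ⟹ volume match at every label of `𝔽_l^⋇`** (`exists_logvol_eq_of_pilotKummerIndRelated_of_statement`), and
  **S ∧ (volume mismatch at one label of `𝔽_l^⋇`) ⟹ ¬Statement ∧ ¬BridgeHyps** (`not_statement_of_pilotKummerIndRelated_of_ne`).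
  abc-iut-E-cx's `not_statement_of_pilotKummerIndRelated_of_thetaBelow` is recovered WITHOUT its `LogvolMono` / `PinnedRegions` /
  q-admissibility hypotheses (`not_statement_of_pilotKummerIndRelated_of_thetaBelow'`), together with its Joshi-frame twin
  (`…_of_qBelow`, Θ above q).
* §3: with the two pins, S ∧ `H1` ∧ defined hulls ⟹ `VolumeTransport P` with no `LogvolMono` (`volumeTransport_of_pilotKummerIndRelated'`),
  and `ThetaBelowQ P` ⟹ volume mismatch at a label of `𝔽_l^⋇` (`exists_logvol_ne_of_thetaBelowQ`); at abc-iut-w4-d101's pinned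
  countermodel the mismatch is at the label `j = 2` (`B_4` vs `B_1`: `pinnedSetting_logvol_ne`).
LOCATED SENTENCE (tree currency, no side taken): whatever typed normalisation is chosen for the Θ- and q-data, S can coexist with the
printed Statement (under the dichotomy) ONLY at settings where, at EVERY label `j ∈ 𝔽_l^⋇`, some Θ-Kummer datum region has exactly the
log-volume of the q-datum region; honest exponents violate this for `ℓ* ≥ 2` in BOTH normalisations named above. Volume match is
NECESSARY, not sufficient, for S (S is an identity of regions). [claim: Mochizuki2012, status: disputed] [claim: Joshi2024ATS3,
status: disputed]. Standard axioms only; no `sorry`.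
-/

noncomputable section

open Set

namespace Summit.ABC.IUTFork.Joshi

open Thm311 Cor312 Cor312Vol

variable {T : ThetaIndex} {S : LatticeSituation T} {P : Cor312.Setting S.toSituation}
  {ρ : (∀ v : T.V, v ∈ T.Vbad → Set (S.L.StarPacket v)) → ∀ (j : T.Label) (vQ : T.VQ), Set (S.L.Packet j vQ)}
  {qK : ∀ v : T.V, v ∈ T.Vbad → Set (S.L.StarPacket v)}

/-! ## 1. Under generator-level volume invariance: S ⟹ volume match everywhere -/

/-- **Identity form ⟹ volume match** at any packet whose Θ-Kummer datum regions are admissible, when the (Ind1)/(Ind2) generators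
transport admissibility and preserve log-volume. [folklore] -/
theorem exists_logvol_eq_of_pilotKummerCompatRegion_of_logvolInvariant
    (hAdm : ∀ Φ ∈ S.L.Ind1Family ∪ S.L.Ind2Family, ∀ (j : T.Label) (vQ : T.VQ) (A : Set (S.L.Packet j vQ)),
      (S.D P.n).Adm j vQ A ↔ (S.D P.n).Adm j vQ (Φ j vQ '' A))
    (hvol : (S.D P.n).LogvolInvariant) {j : T.Label} {vQ : T.VQ}
    (hΘ : ∀ m : ℤ, (S.D P.n).Adm j vQ (ρ ((S.col P.n).frobΨ m) j vQ))
    (h : PilotKummerCompatRegion S P ρ qK) :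
    ∃ m : ℤ, (S.D P.n).logvol j vQ (ρ qK j vQ) = (S.D P.n).logvol j vQ (ρ ((S.col P.n).frobΨ m) j vQ) := by
  obtain ⟨Φ, hΦ, m, hm⟩ := h j vQ
  refine ⟨m, ?_⟩
  rw [hm]
  exact (MRData.adm_and_logvol_eq_of_mem_closure (S.D P.n) hAdm hvol hΦ j vQ _ (hΘ m)).2

/-- **S ⟹ volume match** (Thm 3.11 (ii)(b) for column `n` and (hρ) turn S into the identity form). [claim: Mochizuki2012, status: disputed] -/
theorem exists_logvol_eq_of_pilotKummerIndRelated_of_logvolInvariant (hKumB : (S.col P.n).KummerB (S.D P.n))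
    (hρ : ∀ Φ ∈ Subgroup.closure (S.L.Ind1Family ∪ S.L.Ind2Family),
      ∀ (Ψ : ∀ v : T.V, v ∈ T.Vbad → Set (S.L.StarPacket v)) (j : T.Label) (vQ : T.VQ),
        ρ (fun v hv => S.L.starAut Φ v '' Ψ v hv) j vQ = Φ j vQ '' ρ Ψ j vQ)
    (hAdm : ∀ Φ ∈ S.L.Ind1Family ∪ S.L.Ind2Family, ∀ (j : T.Label) (vQ : T.VQ) (A : Set (S.L.Packet j vQ)),
      (S.D P.n).Adm j vQ A ↔ (S.D P.n).Adm j vQ (Φ j vQ '' A))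
    (hvol : (S.D P.n).LogvolInvariant) {j : T.Label} {vQ : T.VQ}
    (hΘ : ∀ m : ℤ, (S.D P.n).Adm j vQ (ρ ((S.col P.n).frobΨ m) j vQ))
    (hS : PilotKummerIndRelated S P ρ qK) :
    ∃ m : ℤ, (S.D P.n).logvol j vQ (ρ qK j vQ) = (S.D P.n).logvol j vQ (ρ ((S.col P.n).frobΨ m) j vQ) :=
  exists_logvol_eq_of_pilotKummerCompatRegion_of_logvolInvariant hAdm hvol hΘ
    ((pilotKummerCompatRegion_iff_pilotKummerIndRelated S P ρ qK hKumB hρ).2 hS)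

/-- **The `≠`-form NO-GO for the identity form**: a volume mismatch at ONE packet (every Θ-Kummer datum region there has log-volume
different from the q-datum region's — in either direction) refutes `PilotKummerCompatRegion` under generator-level volume invariance.
No `LogvolMono`, no admissibility of the q-region. [folklore] -/
theorem not_pilotKummerCompatRegion_of_logvolInvariant_of_ne
    (hAdm : ∀ Φ ∈ S.L.Ind1Family ∪ S.L.Ind2Family, ∀ (j : T.Label) (vQ : T.VQ) (A : Set (S.L.Packet j vQ)),
      (S.D P.n).Adm j vQ A ↔ (S.D P.n).Adm j vQ (Φ j vQ '' A))
    (hvol : (S.D P.n).LogvolInvariant) {j : T.Label} {vQ : T.VQ}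
    (hΘ : ∀ m : ℤ, (S.D P.n).Adm j vQ (ρ ((S.col P.n).frobΨ m) j vQ))
    (hne : ∀ m : ℤ, (S.D P.n).logvol j vQ (ρ ((S.col P.n).frobΨ m) j vQ) ≠ (S.D P.n).logvol j vQ (ρ qK j vQ)) :
    ¬ PilotKummerCompatRegion S P ρ qK := fun h => by
  obtain ⟨m, hm⟩ := exists_logvol_eq_of_pilotKummerCompatRegion_of_logvolInvariant hAdm hvol hΘ h
  exact hne m hm.symm

/-- **The `≠`-form NO-GO for S itself.** [claim: Mochizuki2012, status: disputed] -/
theorem not_pilotKummerIndRelated_of_logvolInvariant_of_ne (hKumB : (S.col P.n).KummerB (S.D P.n))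
    (hρ : ∀ Φ ∈ Subgroup.closure (S.L.Ind1Family ∪ S.L.Ind2Family),
      ∀ (Ψ : ∀ v : T.V, v ∈ T.Vbad → Set (S.L.StarPacket v)) (j : T.Label) (vQ : T.VQ),
        ρ (fun v hv => S.L.starAut Φ v '' Ψ v hv) j vQ = Φ j vQ '' ρ Ψ j vQ)
    (hAdm : ∀ Φ ∈ S.L.Ind1Family ∪ S.L.Ind2Family, ∀ (j : T.Label) (vQ : T.VQ) (A : Set (S.L.Packet j vQ)),
      (S.D P.n).Adm j vQ A ↔ (S.D P.n).Adm j vQ (Φ j vQ '' A))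
    (hvol : (S.D P.n).LogvolInvariant) {j : T.Label} {vQ : T.VQ}
    (hΘ : ∀ m : ℤ, (S.D P.n).Adm j vQ (ρ ((S.col P.n).frobΨ m) j vQ))
    (hne : ∀ m : ℤ, (S.D P.n).logvol j vQ (ρ ((S.col P.n).frobΨ m) j vQ) ≠ (S.D P.n).logvol j vQ (ρ qK j vQ)) :
    ¬ PilotKummerIndRelated S P ρ qK := fun hS =>
  not_pilotKummerCompatRegion_of_logvolInvariant_of_ne hAdm hvol hΘ hne
    ((pilotKummerCompatRegion_iff_pilotKummerIndRelated S P ρ qK hKumB hρ).2 hS)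

/-! ## 2. Under the indeterminacy dichotomy: S ⟹ volume match or hull blow-up, packet by packet -/

/-- **Packetwise: volume match or hull blow-up** — from the IDENTITY form, under the dichotomy `H1` at `(j, v_ℚ)` and admissible
Θ-Kummer datum regions there; no pins, no `LogvolMono`, no volume-invariance hypothesis. [folklore] -/
theorem exists_logvol_eq_or_not_hullDefined_of_pilotKummerCompatRegion {j : T.Label} {vQ : T.VQ}
    (hΘ : ∀ m : ℤ, (S.D P.n).Adm j vQ (ρ ((S.col P.n).frobΨ m) j vQ))
    (H1 : ∀ Φ ∈ Subgroup.closure (S.L.Ind1Family ∪ S.L.Ind2Family),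
      (∀ A : Set (S.L.Packet j vQ), (S.D P.n).Adm j vQ A →
          (S.D P.n).Adm j vQ (Φ j vQ '' A) ∧ (S.D P.n).logvol j vQ (Φ j vQ '' A) = (S.D P.n).logvol j vQ A) ∨
      (∀ H ∈ (P.frame j vQ).Hul, ∃ k : ℕ, ¬ (Φ ^ k) j vQ '' P.thetaRegion3 j vQ ⊆ H))
    (h : PilotKummerCompatRegion S P ρ qK) :
    (∃ m : ℤ, (S.D P.n).logvol j vQ (ρ qK j vQ) = (S.D P.n).logvol j vQ (ρ ((S.col P.n).frobΨ m) j vQ)) ∨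
      ¬ P.HullDefined j vQ := by
  obtain ⟨Φ, hΦ, m, hm⟩ := h j vQ
  rcases H1 Φ hΦ with hv | hd
  · refine Or.inl ⟨m, ?_⟩
    rw [hm]
    exact (hv _ (hΘ m)).2
  · refine Or.inr (not_hullDefined_of_escapes fun H hH => ?_)
    obtain ⟨k, hk⟩ := hd H hH
    exact ⟨_, ⟨Φ ^ k, (Setting.indGroup S.toSituation).pow_mem hΦ k, rfl⟩, hk⟩

/-- **Volume mismatch + identity form ⟹ hull blow-up** at that packet (under the dichotomy there). [folklore] -/
theorem not_hullDefined_of_pilotKummerCompatRegion_of_ne {j : T.Label} {vQ : T.VQ}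
    (hΘ : ∀ m : ℤ, (S.D P.n).Adm j vQ (ρ ((S.col P.n).frobΨ m) j vQ))
    (hne : ∀ m : ℤ, (S.D P.n).logvol j vQ (ρ ((S.col P.n).frobΨ m) j vQ) ≠ (S.D P.n).logvol j vQ (ρ qK j vQ))
    (H1 : ∀ Φ ∈ Subgroup.closure (S.L.Ind1Family ∪ S.L.Ind2Family),
      (∀ A : Set (S.L.Packet j vQ), (S.D P.n).Adm j vQ A →
          (S.D P.n).Adm j vQ (Φ j vQ '' A) ∧ (S.D P.n).logvol j vQ (Φ j vQ '' A) = (S.D P.n).logvol j vQ A) ∨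
      (∀ H ∈ (P.frame j vQ).Hul, ∃ k : ℕ, ¬ (Φ ^ k) j vQ '' P.thetaRegion3 j vQ ⊆ H))
    (h : PilotKummerCompatRegion S P ρ qK) : ¬ P.HullDefined j vQ := by
  rcases exists_logvol_eq_or_not_hullDefined_of_pilotKummerCompatRegion hΘ H1 h with ⟨m, hm⟩ | hnd
  · exact absurd hm.symm (hne m)
  · exact hnd

/-- **S ∧ volume mismatch at a label of `𝔽_l^⋇` ⟹ the printed Statement and the bridge hypotheses FAIL AS TYPED** (`−|log(Θ)| = ⊤`),
under Thm 3.11 (ii)(b) for column `n`, (hρ), admissible Θ-Kummer datum regions and the dichotomy at that packet. The mismatch may be in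
EITHER direction (Θ below q, or Θ above q). [claim: Mochizuki2012, status: disputed] -/
theorem not_statement_of_pilotKummerIndRelated_of_ne (hKumB : (S.col P.n).KummerB (S.D P.n))
    (hρ : ∀ Φ ∈ Subgroup.closure (S.L.Ind1Family ∪ S.L.Ind2Family),
      ∀ (Ψ : ∀ v : T.V, v ∈ T.Vbad → Set (S.L.StarPacket v)) (j : T.Label) (vQ : T.VQ),
        ρ (fun v hv => S.L.starAut Φ v '' Ψ v hv) j vQ = Φ j vQ '' ρ Ψ j vQ)
    {i : Fin T.lstar} {vQ : T.VQ}
    (hΘ : ∀ m : ℤ, (S.D P.n).Adm (Setting.labelSucc i) vQ (ρ ((S.col P.n).frobΨ m) (Setting.labelSucc i) vQ))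
    (hne : ∀ m : ℤ, (S.D P.n).logvol (Setting.labelSucc i) vQ (ρ ((S.col P.n).frobΨ m) (Setting.labelSucc i) vQ) ≠
      (S.D P.n).logvol (Setting.labelSucc i) vQ (ρ qK (Setting.labelSucc i) vQ))
    (H1 : ∀ Φ ∈ Subgroup.closure (S.L.Ind1Family ∪ S.L.Ind2Family),
      (∀ A : Set (S.L.Packet (Setting.labelSucc i) vQ), (S.D P.n).Adm _ vQ A →
          (S.D P.n).Adm _ vQ (Φ _ vQ '' A) ∧ (S.D P.n).logvol _ vQ (Φ _ vQ '' A) = (S.D P.n).logvol _ vQ A) ∨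
      (∀ H ∈ (P.frame (Setting.labelSucc i) vQ).Hul, ∃ k : ℕ,
          ¬ (Φ ^ k) (Setting.labelSucc i) vQ '' P.thetaRegion3 (Setting.labelSucc i) vQ ⊆ H))
    (hS : PilotKummerIndRelated S P ρ qK) : ¬ P.Statement ∧ ¬ BridgeHyps P :=
  have hnd := not_hullDefined_of_pilotKummerCompatRegion_of_ne hΘ hne H1
    ((pilotKummerCompatRegion_iff_pilotKummerIndRelated S P ρ qK hKumB hρ).2 hS)
  ⟨not_statement_of_not_hullDefined hnd, not_bridgeHyps_of_not_hullDefined hnd⟩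

/-- **S ∧ Statement-as-typed ⟹ volume match at every label of `𝔽_l^⋇`** (under Thm 3.11 (ii)(b), (hρ), admissible Θ-Kummer datum
regions and the dichotomy at every packet): the Statement forces every hull `^{n,∘}𝒰_{j,v_ℚ}` to be defined, which excludes the blow-up
horn. The frame-independent NECESSARY CONDITION for the coexistence of S with the printed inequality. [claim: Mochizuki2012, status: disputed] -/
theorem exists_logvol_eq_of_pilotKummerIndRelated_of_statement (hKumB : (S.col P.n).KummerB (S.D P.n))
    (hρ : ∀ Φ ∈ Subgroup.closure (S.L.Ind1Family ∪ S.L.Ind2Family),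
      ∀ (Ψ : ∀ v : T.V, v ∈ T.Vbad → Set (S.L.StarPacket v)) (j : T.Label) (vQ : T.VQ),
        ρ (fun v hv => S.L.starAut Φ v '' Ψ v hv) j vQ = Φ j vQ '' ρ Ψ j vQ)
    (hΘ : ∀ (m : ℤ) (i : Fin T.lstar) (vQ : T.VQ),
      (S.D P.n).Adm (Setting.labelSucc i) vQ (ρ ((S.col P.n).frobΨ m) (Setting.labelSucc i) vQ))
    (H1 : ∀ Φ ∈ Subgroup.closure (S.L.Ind1Family ∪ S.L.Ind2Family), ∀ (i : Fin T.lstar) (vQ : T.VQ),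
      (∀ A : Set (S.L.Packet (Setting.labelSucc i) vQ), (S.D P.n).Adm _ vQ A →
          (S.D P.n).Adm _ vQ (Φ _ vQ '' A) ∧ (S.D P.n).logvol _ vQ (Φ _ vQ '' A) = (S.D P.n).logvol _ vQ A) ∨
      (∀ H ∈ (P.frame (Setting.labelSucc i) vQ).Hul, ∃ k : ℕ,
          ¬ (Φ ^ k) (Setting.labelSucc i) vQ '' P.thetaRegion3 (Setting.labelSucc i) vQ ⊆ H))
    (hS : PilotKummerIndRelated S P ρ qK) (hst : P.Statement) (i : Fin T.lstar) (vQ : T.VQ) :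
    ∃ m : ℤ, (S.D P.n).logvol (Setting.labelSucc i) vQ (ρ qK (Setting.labelSucc i) vQ) =
      (S.D P.n).logvol (Setting.labelSucc i) vQ (ρ ((S.col P.n).frobΨ m) (Setting.labelSucc i) vQ) :=
  (exists_logvol_eq_or_not_hullDefined_of_pilotKummerCompatRegion (fun m => hΘ m i vQ) (fun Φ hΦ => H1 Φ hΦ i vQ)
    ((pilotKummerCompatRegion_iff_pilotKummerIndRelated S P ρ qK hKumB hρ).2 hS)).resolve_right
    (fun hnd => not_statement_of_not_hullDefined hnd hst)

/-- abc-iut-E-cx's `not_statement_of_pilotKummerIndRelated_of_thetaBelow` (Θ STRICTLY BELOW q at a packet) recovered without its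
`LogvolMono`, `PinnedRegions` and q-admissibility hypotheses ((hρ) is kept: it is clause 1 of the Θ-pin). [claim: Mochizuki2012, status: disputed] -/
theorem not_statement_of_pilotKummerIndRelated_of_thetaBelow' (hKumB : (S.col P.n).KummerB (S.D P.n))
    (hρ : ∀ Φ ∈ Subgroup.closure (S.L.Ind1Family ∪ S.L.Ind2Family),
      ∀ (Ψ : ∀ v : T.V, v ∈ T.Vbad → Set (S.L.StarPacket v)) (j : T.Label) (vQ : T.VQ),
        ρ (fun v hv => S.L.starAut Φ v '' Ψ v hv) j vQ = Φ j vQ '' ρ Ψ j vQ)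
    {i : Fin T.lstar} {vQ : T.VQ}
    (hΘ : ∀ m : ℤ, (S.D P.n).Adm (Setting.labelSucc i) vQ (ρ ((S.col P.n).frobΨ m) (Setting.labelSucc i) vQ))
    (hlt : ∀ m : ℤ, (S.D P.n).logvol (Setting.labelSucc i) vQ (ρ ((S.col P.n).frobΨ m) (Setting.labelSucc i) vQ) <
      (S.D P.n).logvol (Setting.labelSucc i) vQ (ρ qK (Setting.labelSucc i) vQ))
    (H1 : ∀ Φ ∈ Subgroup.closure (S.L.Ind1Family ∪ S.L.Ind2Family),
      (∀ A : Set (S.L.Packet (Setting.labelSucc i) vQ), (S.D P.n).Adm _ vQ A →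
          (S.D P.n).Adm _ vQ (Φ _ vQ '' A) ∧ (S.D P.n).logvol _ vQ (Φ _ vQ '' A) = (S.D P.n).logvol _ vQ A) ∨
      (∀ H ∈ (P.frame (Setting.labelSucc i) vQ).Hul, ∃ k : ℕ,
          ¬ (Φ ^ k) (Setting.labelSucc i) vQ '' P.thetaRegion3 (Setting.labelSucc i) vQ ⊆ H))
    (hS : PilotKummerIndRelated S P ρ qK) : ¬ P.Statement ∧ ¬ BridgeHyps P :=
  not_statement_of_pilotKummerIndRelated_of_ne hKumB hρ hΘ (fun m => (hlt m).ne) H1 hS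

/-- **The Joshi-frame twin: Θ STRICTLY ABOVE q** at a packet (the normalisation of [J-III] eq. (9.9.4), p.121: at a label `j < ℓ*` the
rescaled Θ-coordinate region is strictly LARGER than the q-region) — S again forces ¬Statement ∧ ¬BridgeHyps there, under the same
dictionary-free hypotheses. [claim: Joshi2024ATS3, status: disputed] -/
theorem not_statement_of_pilotKummerIndRelated_of_qBelow (hKumB : (S.col P.n).KummerB (S.D P.n))
    (hρ : ∀ Φ ∈ Subgroup.closure (S.L.Ind1Family ∪ S.L.Ind2Family),
      ∀ (Ψ : ∀ v : T.V, v ∈ T.Vbad → Set (S.L.StarPacket v)) (j : T.Label) (vQ : T.VQ),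
        ρ (fun v hv => S.L.starAut Φ v '' Ψ v hv) j vQ = Φ j vQ '' ρ Ψ j vQ)
    {i : Fin T.lstar} {vQ : T.VQ}
    (hΘ : ∀ m : ℤ, (S.D P.n).Adm (Setting.labelSucc i) vQ (ρ ((S.col P.n).frobΨ m) (Setting.labelSucc i) vQ))
    (hgt : ∀ m : ℤ, (S.D P.n).logvol (Setting.labelSucc i) vQ (ρ qK (Setting.labelSucc i) vQ) <
      (S.D P.n).logvol (Setting.labelSucc i) vQ (ρ ((S.col P.n).frobΨ m) (Setting.labelSucc i) vQ))
    (H1 : ∀ Φ ∈ Subgroup.closure (S.L.Ind1Family ∪ S.L.Ind2Family),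
      (∀ A : Set (S.L.Packet (Setting.labelSucc i) vQ), (S.D P.n).Adm _ vQ A →
          (S.D P.n).Adm _ vQ (Φ _ vQ '' A) ∧ (S.D P.n).logvol _ vQ (Φ _ vQ '' A) = (S.D P.n).logvol _ vQ A) ∨
      (∀ H ∈ (P.frame (Setting.labelSucc i) vQ).Hul, ∃ k : ℕ,
          ¬ (Φ ^ k) (Setting.labelSucc i) vQ '' P.thetaRegion3 (Setting.labelSucc i) vQ ⊆ H))
    (hS : PilotKummerIndRelated S P ρ qK) : ¬ P.Statement ∧ ¬ BridgeHyps P :=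
  not_statement_of_pilotKummerIndRelated_of_ne hKumB hρ hΘ (fun m => (hgt m).ne') H1 hS

/-! ## 3. With the two pins: volume transport without `LogvolMono`, and where the mismatch sits -/

/-- **S ∧ defined hulls ⟹ VT with no `LogvolMono`** (compare abc-iut-E-cx's `volumeTransport_of_pilotKummerIndRelated`): under the
pins the matched log-volume IS the q-pilot contribution, so `qLocal ≤ logvol (Θ-Kummer image)` holds with equality.
[claim: Mochizuki2012, status: disputed] -/
theorem volumeTransport_of_pilotKummerIndRelated' (hKumB : (S.col P.n).KummerB (S.D P.n)) (hpin : PinnedRegions S P ρ qK)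
    (hΘ : ∀ (m : ℤ) (i : Fin T.lstar) (vQ : T.VQ),
      (S.D P.n).Adm (Setting.labelSucc i) vQ (ρ ((S.col P.n).frobΨ m) (Setting.labelSucc i) vQ))
    (H1 : ∀ Φ ∈ Subgroup.closure (S.L.Ind1Family ∪ S.L.Ind2Family), ∀ (i : Fin T.lstar) (vQ : T.VQ),
      (∀ A : Set (S.L.Packet (Setting.labelSucc i) vQ), (S.D P.n).Adm _ vQ A →
          (S.D P.n).Adm _ vQ (Φ _ vQ '' A) ∧ (S.D P.n).logvol _ vQ (Φ _ vQ '' A) = (S.D P.n).logvol _ vQ A) ∨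
      (∀ H ∈ (P.frame (Setting.labelSucc i) vQ).Hul, ∃ k : ℕ,
          ¬ (Φ ^ k) (Setting.labelSucc i) vQ '' P.thetaRegion3 (Setting.labelSucc i) vQ ⊆ H))
    (hdef : ∀ (i : Fin T.lstar) (vQ : T.VQ), P.HullDefined (Setting.labelSucc i) vQ)
    (hS : PilotKummerIndRelated S P ρ qK) : VolumeTransport P := fun i vQ => by
  obtain ⟨m, hm⟩ := (exists_logvol_eq_or_not_hullDefined_of_pilotKummerCompatRegion (fun m => hΘ m i vQ)
    (fun Φ hΦ => H1 Φ hΦ i vQ) ((pilotKummerCompatRegion_iff_pilotKummerIndRelated S P ρ qK hKumB hpin.1.1).2 hS)).resolve_right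
    (not_not.2 (hdef i vQ))
  refine ⟨m, le_of_eq ?_⟩
  unfold Setting.qLocal
  rw [hpin.2 _ vQ, hpin.1.2 m _ vQ]
  exact hm

/-- Under the pins, `ThetaBelowQ P` (stated on the Setting's own Θ- and q-regions) is a volume MISMATCH of the datum regions at a label of
`𝔽_l^⋇`. [folklore] -/
theorem exists_logvol_ne_of_thetaBelowQ (hpin : PinnedRegions S P ρ qK) (h : ThetaBelowQ P) :
    ∃ (i : Fin T.lstar) (vQ : T.VQ), ∀ m : ℤ,
      (S.D P.n).logvol (Setting.labelSucc i) vQ (ρ ((S.col P.n).frobΨ m) (Setting.labelSucc i) vQ) ≠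
        (S.D P.n).logvol (Setting.labelSucc i) vQ (ρ qK (Setting.labelSucc i) vQ) := by
  obtain ⟨i, vQ, hlt⟩ := h
  refine ⟨i, vQ, fun m => ?_⟩
  have h' := hlt m
  unfold Setting.qLocal at h'
  rw [hpin.2 _ vQ, hpin.1.2 m _ vQ] at h'
  exact h'.ne

section Pinned

open Cor312.Checks Cor312.IdentifiedNonVacuity PinnedWitness NaiveWitness GluedMonoids.Naive

variable (p : ℕ) [hp : Fact p.Prime]

/-- At abc-iut-w4-d101's pinned countermodel the datum regions MISMATCH in volume at some label of `𝔽_l^⋇` (in fact at `j = 2`: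
`B_4` of log-volume `−4·log p` against `B_1` of log-volume `−log p`). [folklore] -/
theorem pinnedSetting_logvol_ne :
    ∃ (i : Fin toyIndex.lstar) (vQ : toyIndex.VQ), ∀ m : ℤ,
      ((naiveFull p).toLatticeSituation.D (pinnedSetting p).n).logvol (Setting.labelSucc i) vQ
          (orbitRegion p (((naiveFull p).toLatticeSituation.col (pinnedSetting p).n).frobΨ m) (Setting.labelSucc i) vQ) ≠
        ((naiveFull p).toLatticeSituation.D (pinnedSetting p).n).logvol (Setting.labelSucc i) vQ
          (orbitRegion p (qDatum p) (Setting.labelSucc i) vQ) :=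
  exists_logvol_ne_of_thetaBelowQ (pinnedSetting_pinnedRegions p) (thetaBelowQ_pinnedSetting p)

end Pinned

end Summit.ABC.IUTFork.Joshi

end
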